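import Summits.MatrixMultiplication.OmegaCensus.C2SemidirectZ4Law
import HarnessLib

/-!
# `𝔽₂^k × G(A, c₀) = G(𝔽₂^k × A, (0, c₀))`, and `β(C₂^k × (ℤ_n ⋊ ℤ₄)) = 2^k · 16n/3` for `3 ∣ n`

ω-census, family (b3).  Framing: lottery ticket; floor = certified bounds/negative ranges.

`c2pow_product_presentation`: a dihedral-like presentation `(ρ, τ, c₀)` of `G` over `A` induces one of
`Multiplicative (Fin k → ZMod 2) × G` over `(Fin k → ZMod 2) × A` with `c₀' = (0, c₀)` (the elementary abelian factor is
central since `−v = v`); this generalises `c2_product_presentation` (`k = 1` up to `ZMod 2 ≃ (Fin 1 → ZMod 2)`).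
Application: `ℤ_n ⋊ ℤ₄ = G(ℤ₂ × ℤ_n, (1,0))` (`DihedralLikeModel.lean`); for `3 ∣ n` the general law `3V ≤ 8|A| = 2^k · 16n`
is attained by `(C₂^k, 1, 1) ×` the lifted dihedral family (`z2zn_volume_ge_law`):
**`c2pow_semidirect_law`: β(C₂^k × (ℤ_n ⋊ ℤ₄)) = 2^k · 16n/3 for every `k` and every `n ≥ 3` with `3 ∣ n`.**
-/

namespace Summit.MatrixMultiplication.OmegaCensus

open Literature.Combinatorics.Additive Finset
open Summit.MatrixMultiplication.MatrixMultiplication.Theorems.JuntaBranch.Planting (tpp_product)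

section Presentation

variable {A : Type*} [AddCommGroup A] {G : Type} [Group G] {ρ τ : A → G} {c₀ : A} {k : ℕ}

/-- **`𝔽₂^k × G(A, c₀) = G(𝔽₂^k × A, (0, c₀))`**, packaged. [folklore] -/
theorem c2pow_product_presentation
    (hρρ : ∀ a b, ρ a * ρ b = ρ (a + b)) (hρτ : ∀ a b, ρ a * τ b = τ (b - a))
    (hτρ : ∀ a b, τ a * ρ b = τ (a + b)) (hττ : ∀ a b, τ a * τ b = ρ (c₀ + b - a))
    (hρ : Function.Injective ρ) (hτ : Function.Injective τ) (hne : ∀ a b, ρ a ≠ τ b)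
    (hsurj : ∀ g, (∃ a, ρ a = g) ∨ (∃ a, τ a = g)) {P : Prop}
    (K : ∀ (ρ' τ' : (Fin k → ZMod 2) × A → Multiplicative (Fin k → ZMod 2) × G) (c₀' : (Fin k → ZMod 2) × A),
      (∀ a b, ρ' a * ρ' b = ρ' (a + b)) → (∀ a b, ρ' a * τ' b = τ' (b - a)) → (∀ a b, τ' a * ρ' b = τ' (a + b)) →
      (∀ a b, τ' a * τ' b = ρ' (c₀' + b - a)) → Function.Injective ρ' → Function.Injective τ' →
      (∀ a b, ρ' a ≠ τ' b) → (∀ g, (∃ a, ρ' a = g) ∨ (∃ a, τ' a = g)) → c₀' = ((0 : Fin k → ZMod 2), c₀) → P) :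
    P := by
  have hneg : ∀ v : Fin k → ZMod 2, -v = v := fun v => funext fun i => ZMod.neg_eq_self_mod_two (v i)
  exact K (fun p => (Multiplicative.ofAdd p.1, ρ p.2)) (fun p => (Multiplicative.ofAdd p.1, τ p.2))
    ((0 : Fin k → ZMod 2), c₀)
    (fun a b => by simp only [Prod.mk_mul_mk, hρρ, ← ofAdd_add, Prod.fst_add, Prod.snd_add])
    (fun a b => by
      simp only [Prod.mk_mul_mk, hρτ, ← ofAdd_add, Prod.fst_sub, Prod.snd_sub]
      rw [sub_eq_add_neg b.1, hneg, add_comm b.1])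
    (fun a b => by simp only [Prod.mk_mul_mk, hτρ, ← ofAdd_add, Prod.fst_add, Prod.snd_add])
    (fun a b => by
      simp only [Prod.mk_mul_mk, hττ, ← ofAdd_add, Prod.fst_sub, Prod.snd_sub, Prod.fst_add, Prod.snd_add, zero_add]
      rw [sub_eq_add_neg b.1, hneg, add_comm b.1])
    (fun a b hab => by
      simp only [Prod.mk.injEq] at hab
      exact Prod.ext (Multiplicative.ofAdd.injective hab.1) (hρ hab.2))
    (fun a b hab => by
      simp only [Prod.mk.injEq] at hab
      exact Prod.ext (Multiplicative.ofAdd.injective hab.1) (hτ hab.2))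
    (fun a b hab => by
      simp only [Prod.mk.injEq] at hab
      exact hne _ _ hab.2)
    (fun g => by
      obtain ⟨i, x⟩ := g
      rcases hsurj x with ⟨a, ha⟩ | ⟨a, ha⟩
      · exact Or.inl ⟨(Multiplicative.toAdd i, a), by simp [ha]⟩
      · exact Or.inr ⟨(Multiplicative.toAdd i, a), by simp [ha]⟩)
    rfl

end Presentation

section C2PowSD

variable {k n : ℕ} [NeZero n]

/-- **Upper bound** (general law): `|S||T||U| ≤ 2^k · 16n/3` in `C₂^k × (ℤ_n ⋊ ℤ₄)` when `3 ∣ n`. [folklore] -/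
theorem c2pow_semidirect_tpp_volume_le (h3 : 3 ∣ n)
    {S T U : Finset (Multiplicative (Fin k → ZMod 2) × DihedralLikeGroup (ZMod 2 × ZMod n) ((1 : ZMod 2), 0))}
    (h : TripleProductProperty S T U) : S.card * T.card * U.card ≤ 2 ^ k * (16 * n / 3) := by
  refine c2pow_product_presentation (k := k) (A := ZMod 2 × ZMod n)
    (ρ := (DihedralLikeGroup.rho : ZMod 2 × ZMod n → DihedralLikeGroup (ZMod 2 × ZMod n) ((1 : ZMod 2), 0)))
    (τ := DihedralLikeGroup.tau) (c₀ := ((1 : ZMod 2), (0 : ZMod n))) DihedralLikeGroup.rho_mul_rho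
    DihedralLikeGroup.rho_mul_tau DihedralLikeGroup.tau_mul_rho DihedralLikeGroup.tau_mul_tau
    DihedralLikeGroup.rho_injective DihedralLikeGroup.tau_injective DihedralLikeGroup.rho_ne_tau
    DihedralLikeGroup.rho_or_tau fun ρ' τ' c₀' hρρ' hρτ' hτρ' hττ' hρ' hτ' hne' hsurj' _ => ?_
  have key := tpp_volume_le_of_dihedralLike hρρ' hρτ' hτρ' hττ' hρ' hτ' hne' hsurj' h
  have hcard : Fintype.card ((Fin k → ZMod 2) × (ZMod 2 × ZMod n)) = 2 ^ k * (2 * n) := by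
    rw [Fintype.card_prod, Fintype.card_prod, Fintype.card_fun, ZMod.card, ZMod.card, Fintype.card_fin]
  rw [hcard] at key
  obtain ⟨q, rfl⟩ := h3
  have e : 16 * (3 * q) / 3 = 16 * q := by
    rw [show 16 * (3 * q) = 3 * (16 * q) by ring, Nat.mul_div_cancel_left _ (by norm_num)]
  rw [e]
  have key' : 3 * (S.card * T.card * U.card) ≤ 3 * (2 ^ k * (16 * q)) := by
    calc 3 * (S.card * T.card * U.card) ≤ 8 * (2 ^ k * (2 * (3 * q))) := key
      _ = 3 * (2 ^ k * (16 * q)) := by ring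
  exact Nat.le_of_mul_le_mul_left key' (by norm_num)

/-- **Lower bound**: `(C₂^k, 1, 1) ×` the lifted dihedral family of `ℤ_n ⋊ ℤ₄` (`n ≥ 3`, `3 ∣ n`). [folklore] -/
theorem c2pow_semidirect_volume_ge (hn : 3 ≤ n) (h3 : 3 ∣ n) :
    ∃ S T U : Finset (Multiplicative (Fin k → ZMod 2) × DihedralLikeGroup (ZMod 2 × ZMod n) ((1 : ZMod 2), 0)),
      TripleProductProperty S T U ∧ S.card * T.card * U.card = 2 ^ k * (16 * n / 3) := by
  obtain ⟨S, T, U, h, hvol⟩ := z2zn_volume_ge_law (n := n) (ε := 1) hn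
  refine ⟨univ ×ˢ S, {1} ×ˢ T, {1} ×ˢ U, tpp_product tpp_univ_one_one h, ?_⟩
  rw [card_product, card_product, card_product, card_univ, card_singleton, Fintype.card_multiplicative,
    Fintype.card_fun, ZMod.card, Fintype.card_fin]
  have e : 2 ^ k * S.card * (1 * T.card) * (1 * U.card) = 2 ^ k * (S.card * T.card * U.card) := by ring
  rw [e, hvol]
  obtain ⟨q, rfl⟩ := h3
  rw [show 2 * (3 * q) = 3 * (2 * q) by ring, show 16 * (3 * q) = 3 * (16 * q) by ring,
    Nat.mul_div_cancel_left _ (by norm_num), Nat.mul_div_cancel_left _ (by norm_num)]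
  ring

/-- **`β(C₂^k × (ℤ_n ⋊ ℤ₄)) = 2^k · 16n/3` for every `k` and every `n ≥ 3` with `3 ∣ n`** (kernel). [folklore] -/
theorem c2pow_semidirect_law (hn : 3 ≤ n) (h3 : 3 ∣ n) :
    (∀ S T U : Finset (Multiplicative (Fin k → ZMod 2) × DihedralLikeGroup (ZMod 2 × ZMod n) ((1 : ZMod 2), 0)),
        TripleProductProperty S T U → S.card * T.card * U.card ≤ 2 ^ k * (16 * n / 3)) ∧
    ∃ S T U : Finset (Multiplicative (Fin k → ZMod 2) × DihedralLikeGroup (ZMod 2 × ZMod n) ((1 : ZMod 2), 0)),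
      TripleProductProperty S T U ∧ S.card * T.card * U.card = 2 ^ k * (16 * n / 3) :=
  ⟨fun _ _ _ h => c2pow_semidirect_tpp_volume_le h3 h, c2pow_semidirect_volume_ge hn h3⟩

end C2PowSD

end Summit.MatrixMultiplication.OmegaCensus
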